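import Summits.HodgeConjecture.HodgeConjecture.Theorems.F0P3cStCharTSHCDescentSemisimpleCentreCoords   -- (this seat) E₁: `exists_coords_centraliser`; brings ★ file A `discr_charpoly_diagonal_add_of_commute`
import Summits.HodgeConjecture.HodgeConjecture.Theorems.F0P3cStCharTSQuadraticFormNegHalf               -- ★ p852106 (F0P3b-p01) D3b: `forall_exists_nhds_setLIntegral_quadraticForm_neg_half_lt_top`
import Literature.MeasureTheory.Group.LocFiniteLIntegralProductTransfer                                -- ★ p852081 (F0P3a-p07) G-FUB: `exists_nhds_setLIntegral_lt_top_of_prod`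
import Summits.HodgeConjecture.HodgeConjecture.Theorems.F0P3cStCharTSHCDCuspDocking                       -- ★ p852208 (F0P3b-p01) (HC): `coe_sqrt_inv_eq_rpow_neg_half` (reused, dedup)
import Literature.NumberTheory.Automorphic.TateLocalZetaShells                                           -- ★ `secondCountableTopology_localField`; brings ★ `LocalFieldHaar.continuous_normAbs`, `normAbs_add_eq_of_lt`
import Mathlib.Analysis.SpecialFunctions.Pow.Continuity
import HarnessLib

/-!
# F0 · P3c · line LH6 «StCharTS» — ROAD «HC-D», brick (D5ii) «SEMISIMPLE DESCENT AT TYPE (a,a,b)», file E₂ (ii-Q) «THE CENTRALISER INTEGRAL IN NORMAL FORM»: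
# `ηι(D + Z) = |disc χ_{D+Z}|_K^{−1∕4}` is `∫⁻`-finite on a neighbourhood of `0` in the centraliser slice `𝔠` of `D = diag(a,a,b)` for `J′ = diag(ι d)`

Cell `pub/hodgecm-mathlib`, crux H413 = `stmt-HodgeConjecture-24833` (lane `--supports … --as helper`), route HCCMUnconditional; seat F0P3a-p05 (g23), brick (ii-Q) of the split
(D5ii) = (ii-B) normal-form basis (F0P3-p02) + (ii-T) transport (LH6-p02) + (ii-Q) (this seat) + ★ file D `exists_nhds_setLIntegral_lt_top_of_slice` (dealer F0P2-p01 (g23), 16:57:16Z).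
THEOREMS ONLY (no definition ∕ instance ∕ notation ∕ named fact ∕ `sorry`); imports (this seat) E₁ + ★ D3b + ★ G-FUB + ★ (HC) docking + ★ `TateLocalZetaShells` + Mathlib.  SCALAR-FREE frame (R3♭):
(CO) docking letters `ι : F′ →+* K`, `lam`, norm bridge `normAbs K (ι x) = normAbs F′ x ^ 2`; integrand = the R2 token `ηι X := (↑(√(√(normAbs K (charpoly X).discr))))⁻¹`.
HONEST LABEL: HC_CM is proved only modulo the 7 printed citations (2 remaining: hLiu418 = `stmt-HodgeConjecture-24832`, h413 = `stmt-HodgeConjecture-24833`)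
until rung 0 closes; count-neutral analysis for the named input (HC-D) «`|D_G|^{−1∕2} ∈ L¹_loc(G)`» [HarishChandra1970, Part VII §1 Thm. 15]; closes no organ.

THE MATHEMATICS.  On `𝔠 ≅ (Fin 2 → F′) × (Fin 3 → F′)` (E₁ `exists_coords_centraliser`, coordinates `(z; y)`), ★ file A gives `disc χ_{D+Z} = q·Res²` with `q = (Z₀₀ − Z₁₁)² + 4Z₀₁Z₁₀ =
ι(e y₀² − 4d′y₁² + 4d′e y₂²) = ι (y ⬝ᵥ B *ᵥ y)`, `B = diag(e, −4d′, 4d′e)` (`ι e = lam²`, `d′ = d₀∕d₁`; `det B ≠ 0`), and `Res(0) = (b − a)² ≠ 0`, so `|Res| = |b − a|²` on the neighbourhood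
`N₀ = {|Res − (b−a)²| < |(b−a)²|}` (ultrametric).  There `ηι(D + Φ(z,y)) = |b − a|_K^{−1} · |y ⬝ᵥ B *ᵥ y|_{F′}^{−1∕2}` (norm bridge), a function of `y` alone; ★ D3b gives a neighbourhood of
`0 ∈ F′³` where `|y ⬝ᵥ B *ᵥ y|^{−1∕2}` is `∫⁻`-finite for `Measure.pi μF`, ★ G-FUB `exists_nhds_setLIntegral_lt_top_of_prod` ascends it along `Φ` to `𝔠` (ANY Haar measure on `𝔠`, constants by
uniqueness), and intersecting with `N₀` gives **`exists_nhds_setLIntegral_etaInv_lt_top_normalForm`**: `∃ U ∈ 𝓝 (0 : ↥𝔠), ∫⁻ Z in U, ηι (diagonal ![a,a,b] + Z) ∂μ𝔠 < ∞`.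

## References
* [HarishChandra1970] Harish-Chandra (notes by G. van Dijk), *Harmonic Analysis on Reductive p-adic Groups*, LNM 162 (1970), Part VI Lemma 22; Part VII §1 Thm. 15.
* [Rogawski1990] J. D. Rogawski, *Automorphic Representations of Unitary Groups in Three Variables*, Ann. of Math. Stud. 123 (1990), §3.6 pp. 28–31; §12.5 p. 184.
* [Folland1999] G. B. Folland, *Real Analysis* (2nd ed., 1999), §2.5 Thm. 2.37, §11.1 Thm. 11.9.
-/

set_option autoImplicit false
-- the mandated namespace has the single-problem summit's repeated segment (`HodgeConjecture.HodgeConjecture`)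
set_option linter.dupNamespace false

noncomputable section

open MeasureTheory MeasureTheory.Measure Filter Topology Set Matrix
open scoped NNReal ENNReal Matrix
open Literature.NumberTheory.GaloisRepresentations Literature.NumberTheory.Automorphic Literature.NumberTheory.Automorphic.LocalFieldHaar
open Literature.MeasureTheory.Group
open Summit.HodgeConjecture.HodgeConjecture.Cruxes.H413.F0P3cStCharTSHCDescentSemisimpleAlg
open Summit.HodgeConjecture.HodgeConjecture.Cruxes.H413.F0P3cStCharTSHCDescentSemisimpleCentreCoords
open Summit.HodgeConjecture.HodgeConjecture.Cruxes.H413.F0P3cStCharTSQuadraticFormNegHalf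
open Summit.HodgeConjecture.HodgeConjecture.Cruxes.H413.F0P3cStCharTSHCDCuspDocking

namespace Summit.HodgeConjecture.HodgeConjecture.Cruxes.H413.F0P3cStCharTSHCDescentSemisimpleNormalForm

/-! ## §1 `ℝ≥0∞` bookkeeping for the R2 token -/

/-- `√(√(u²·v²)) = √u · √v` in `ℝ≥0`. [cite: Folland1999, §2.5 Thm. 2.37] -/
theorem sqrt_sqrt_sq_mul_sq (u v : ℝ≥0) : NNReal.sqrt (NNReal.sqrt (u ^ 2 * v ^ 2)) = NNReal.sqrt u * NNReal.sqrt v := by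
  rw [NNReal.sqrt_mul, NNReal.sqrt_sq, NNReal.sqrt_sq, NNReal.sqrt_mul]

/-! ## §2 The centraliser integral in normal form -/

section NormalForm

variable {K : Type*} [Field K] [ValuativeRel K] [TopologicalSpace K] [IsNonarchimedeanLocalField K]
  {F' : Type*} [Field F'] [ValuativeRel F'] [TopologicalSpace F'] [IsNonarchimedeanLocalField F']

/-- **THE CENTRALISER INTEGRAL IN NORMAL FORM (ii-Q).**  `σ` a continuous involution of the local field `K` with fixed field `range ι` (`ι : F′ → K` a closed embedding of
local fields, norm bridge `|ι x|_K = |x|_{F′}²`), `lam` a skew unit, `2 ≠ 0` in `F′`; `J′ = diagonal (ι ∘ d)` (`d i ≠ 0`), `D = diagonal ![a, a, b]` (`a ≠ b`); `𝔠` the `F`-submodule (any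
`F`, e.g. `ℚ`; ★ FILE D ∕ (ii-T) letters) of `J′`-skew matrices commuting with `D` (field hypothesis), with ANY Borel structure and ANY additive Haar measure `μ𝔠`; `μF` any additive Haar measure on `F′`.  Then the R2
integrand `ηι(D + Z) = (↑√√|disc χ_{D+Z}|_K)⁻¹` has finite `∫⁻` on a neighbourhood of `0` in `↥𝔠`. [cite: HarishChandra1970, Part VI Lemma 22; Part VII §1 Thm. 15] [cite: Rogawski1990, §3.6 pp. 28–31] -/
theorem exists_nhds_setLIntegral_etaInv_lt_top_normalForm
    (σ : K →+* K) (hσ : ∀ x, σ (σ x) = x) (hσc : Continuous σ)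
    (ι : F' →+* K) (hι : IsClosedEmbedding ι) (hιr : ∀ x, σ x = x ↔ x ∈ Set.range ι)
    (hιn : ∀ x : F', IsNonarchimedeanLocalField.normAbs K (ι x) = IsNonarchimedeanLocalField.normAbs F' x ^ 2)
    (lam : Kˣ) (hlam : σ lam = -lam) (h2 : (2 : F') ≠ 0)
    (d : Fin 3 → F') (hd : ∀ i, d i ≠ 0) {a b : K} (hab : a ≠ b)
    {F : Type*} [Field F] [Algebra F K] (𝔠 : Submodule F (Matrix (Fin 3) (Fin 3) K))
    (h𝔠 : ∀ Z, Z ∈ 𝔠 ↔ (Z.map σ)ᵀ * diagonal (fun i => ι (d i)) + diagonal (fun i => ι (d i)) * Z = 0 ∧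
      diagonal ![a, a, b] * Z = Z * diagonal ![a, a, b])
    [MeasurableSpace ↥𝔠] [BorelSpace ↥𝔠] (μ𝔠 : Measure ↥𝔠) [μ𝔠.IsAddHaarMeasure]
    [MeasurableSpace F'] [BorelSpace F'] (μF : Measure F') [μF.IsAddHaarMeasure] :
    ∃ U ∈ 𝓝 (0 : ↥𝔠), ∫⁻ Z in U,
      ((NNReal.sqrt (NNReal.sqrt (IsNonarchimedeanLocalField.normAbs K
        (Matrix.charpoly (diagonal ![a, a, b] + (Z : Matrix (Fin 3) (Fin 3) K))).discr)) : ℝ≥0∞))⁻¹ ∂μ𝔠 < ∞ := by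
  haveI : SecondCountableTopology F' := secondCountableTopology_localField F'
  haveI : SecondCountableTopology K := secondCountableTopology_localField K
  have h2K : (2 : K) ≠ 0 := by rw [← map_ofNat ι 2]; exact (map_ne_zero ι).2 h2
  have h4 : (4 : F') ≠ 0 := by
    rw [show (4 : F') = 2 * 2 by norm_num]; exact mul_ne_zero h2 h2
  haveI : T2Space F' := (IsNonarchimedeanLocalField.isLocalField F').toT2Space
  -- coordinates (E₁), on the additive subgroup underlying `𝔠` (same subtype)
  obtain ⟨Φ₀, hΦ₀⟩ := exists_coords_centraliser σ hσ hσc ι hι hιr lam hlam h2K d hd hab 𝔠.toAddSubgroup (fun Z => h𝔠 Z)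
  let Φ : ((Fin 2 → F') × (Fin 3 → F')) ≃ₜ+ ↥𝔠 := Φ₀
  have hΦ : ∀ p : (Fin 2 → F') × (Fin 3 → F'),
      ((Φ p : ↥𝔠) : Matrix (Fin 3) (Fin 3) K) 0 0 = lam * ι (p.2 0 + p.1 0) ∧ ((Φ p : ↥𝔠) : Matrix (Fin 3) (Fin 3) K) 0 1 = ι (p.2 1) + lam * ι (p.2 2) ∧
      ((Φ p : ↥𝔠) : Matrix (Fin 3) (Fin 3) K) 1 0 = -(ι (d 0 / d 1) * (ι (p.2 1) - lam * ι (p.2 2))) ∧ ((Φ p : ↥𝔠) : Matrix (Fin 3) (Fin 3) K) 1 1 = lam * ι (p.1 0) ∧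
      ((Φ p : ↥𝔠) : Matrix (Fin 3) (Fin 3) K) 2 2 = lam * ι (p.1 1) ∧ ((Φ p : ↥𝔠) : Matrix (Fin 3) (Fin 3) K) 0 2 = 0 ∧ ((Φ p : ↥𝔠) : Matrix (Fin 3) (Fin 3) K) 1 2 = 0 ∧
      ((Φ p : ↥𝔠) : Matrix (Fin 3) (Fin 3) K) 2 0 = 0 ∧ ((Φ p : ↥𝔠) : Matrix (Fin 3) (Fin 3) K) 2 1 = 0 := hΦ₀
  -- `lam² = ι e`
  obtain ⟨e, he⟩ : ∃ e : F', ι e = (lam : K) ^ 2 := by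
    obtain ⟨e, he⟩ := (hιr ((lam : K) ^ 2)).1 (by rw [map_pow, hlam, neg_sq])
    exact ⟨e, he⟩
  have he0 : e ≠ 0 := by
    intro h; rw [h, map_zero] at he; exact pow_ne_zero 2 lam.ne_zero he.symm
  have hd' : d 0 / d 1 ≠ 0 := div_ne_zero (hd 0) (hd 1)
  -- the ternary form
  set B : Matrix (Fin 3) (Fin 3) F' := diagonal ![e, -4 * (d 0 / d 1), 4 * (d 0 / d 1) * e] with hB
  have hBs : B.IsSymm := Matrix.isSymm_diagonal _
  have hBd : B.det ≠ 0 := by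
    rw [hB, det_diagonal, Fin.prod_univ_three]
    simp only [Matrix.cons_val_zero, Matrix.cons_val_one, Matrix.head_cons, Matrix.cons_val_two, Matrix.tail_cons]
    exact mul_ne_zero (mul_ne_zero he0 (mul_ne_zero (neg_ne_zero.2 h4) hd')) (mul_ne_zero (mul_ne_zero h4 hd') he0)
  have hQ : ∀ y : Fin 3 → F', y ⬝ᵥ B *ᵥ y = e * y 0 ^ 2 + -4 * (d 0 / d 1) * y 1 ^ 2 + 4 * (d 0 / d 1) * e * y 2 ^ 2 := fun y => by
    rw [hB, dotProduct, Fin.sum_univ_three]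
    simp only [mulVec_diagonal, Matrix.cons_val_zero, Matrix.cons_val_one, Matrix.head_cons, Matrix.cons_val_two, Matrix.tail_cons]
    ring
  -- the `q`-factor in coordinates
  have hq : ∀ p : (Fin 2 → F') × (Fin 3 → F'),
      (((Φ p : ↥𝔠) : Matrix (Fin 3) (Fin 3) K) 0 0 - ((Φ p : ↥𝔠) : Matrix (Fin 3) (Fin 3) K) 1 1) ^ 2 +
        4 * (((Φ p : ↥𝔠) : Matrix (Fin 3) (Fin 3) K) 0 1 * ((Φ p : ↥𝔠) : Matrix (Fin 3) (Fin 3) K) 1 0) = ι (p.2 ⬝ᵥ B *ᵥ p.2) := by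
    intro p
    obtain ⟨h00, h01, h10, h11, -, -, -, -, -⟩ := hΦ p
    rw [h00, h01, h10, h11, hQ]
    simp only [map_add, map_mul, map_neg, map_pow, map_ofNat]
    linear_combination (-(ι (p.2 0)) ^ 2 - 4 * ι (d 0 / d 1) * ι (p.2 2) ^ 2) * he
  -- the resultant factor and its constancy neighbourhood
  set R : Matrix (Fin 3) (Fin 3) K → K := fun Z => (b + Z 2 2 - a - Z 0 0) * (b + Z 2 2 - a - Z 1 1) - Z 0 1 * Z 1 0 with hR
  have hR0 : R 0 = (b - a) ^ 2 := by simp only [hR, Matrix.zero_apply]; ring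
  have hRc : Continuous fun Z : ↥𝔠 => R (Z : Matrix (Fin 3) (Fin 3) K) := by
    have hent : ∀ i j, Continuous fun X : ↥𝔠 => (X : Matrix (Fin 3) (Fin 3) K) i j :=
      fun i j => (continuous_apply j).comp ((continuous_apply i).comp continuous_subtype_val)
    exact ((((continuous_const.add (hent 2 2)).sub continuous_const).sub (hent 0 0)).mul
      (((continuous_const.add (hent 2 2)).sub continuous_const).sub (hent 1 1))).sub ((hent 0 1).mul (hent 1 0))
  have hρ0 : IsNonarchimedeanLocalField.normAbs K ((b - a) ^ 2) ≠ 0 := by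
    rw [map_ne_zero]; exact pow_ne_zero 2 (sub_ne_zero.2 (Ne.symm hab))
  set N₀ : Set ↥𝔠 := {Z | IsNonarchimedeanLocalField.normAbs K (R (Z : Matrix (Fin 3) (Fin 3) K) - (b - a) ^ 2) <
    IsNonarchimedeanLocalField.normAbs K ((b - a) ^ 2)} with hN₀
  have hN₀o : IsOpen N₀ := isOpen_lt (continuous_normAbs.comp (hRc.sub continuous_const)) continuous_const
  have h0N₀ : (0 : ↥𝔠) ∈ N₀ := by
    show IsNonarchimedeanLocalField.normAbs K (R ((0 : ↥𝔠) : Matrix (Fin 3) (Fin 3) K) - (b - a) ^ 2) < _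
    rw [ZeroMemClass.coe_zero, hR0, sub_self, map_zero]
    exact pos_iff_ne_zero.2 hρ0
  have hRN : ∀ Z ∈ N₀, IsNonarchimedeanLocalField.normAbs K (R (Z : Matrix (Fin 3) (Fin 3) K)) = IsNonarchimedeanLocalField.normAbs K ((b - a) ^ 2) := by
    intro Z hZ
    have h := normAbs_add_eq_of_lt hZ
    rwa [add_sub_cancel] at h
  -- the model integrand on `F′³` and its transport
  set g : (Fin 3 → F') → ℝ≥0∞ := fun y =>
    ((NNReal.sqrt (IsNonarchimedeanLocalField.normAbs K ((b - a) ^ 2)) : ℝ≥0∞))⁻¹ *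
      ((IsNonarchimedeanLocalField.normAbs F' (y ⬝ᵥ B *ᵥ y) : ℝ≥0∞)) ^ (-(1 / 2 : ℝ)) with hg
  have hQc : Continuous fun y : Fin 3 → F' => y ⬝ᵥ B *ᵥ y := by
    simp only [hQ]; fun_prop
  have hFm : Measurable fun y : Fin 3 → F' => ((IsNonarchimedeanLocalField.normAbs F' (y ⬝ᵥ B *ᵥ y) : ℝ≥0∞)) ^ (-(1 / 2 : ℝ)) :=
    (ENNReal.continuous_rpow_const.comp (ENNReal.continuous_coe.comp (continuous_normAbs.comp hQc))).measurable
  have hgm : Measurable g := hFm.const_mul _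
  set f : ↥𝔠 → ℝ≥0∞ := fun Z => g (Φ.symm Z).2 with hf
  have hfg : ∀ (z : Fin 2 → F') (y : Fin 3 → F'), f (Φ (z, y)) = g y := fun z y => by
    simp only [hf, ContinuousAddEquiv.symm_apply_apply]
  -- D3b at `y = 0`
  obtain ⟨U₃, hU₃, hU₃i⟩ := forall_exists_nhds_setLIntegral_quadraticForm_neg_half_lt_top μF hBs hBd h2 0
  have hU₃g : ∫⁻ y in U₃, g y ∂(Measure.pi fun _ : Fin 3 => μF) < ∞ := by
    simp only [hg]
    rw [lintegral_const_mul _ hFm]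
    exact ENNReal.mul_lt_top (ENNReal.inv_lt_top.2 (pos_iff_ne_zero.2 (by exact_mod_cast (mt NNReal.sqrt_eq_zero.1 hρ0)))) hU₃i
  -- ascend along `Φ` (★ G-FUB; any Haar measure on `↥𝔠`)
  haveI : LocallyCompactSpace ↥𝔠 := Φ.toHomeomorph.symm.isClosedEmbedding.locallyCompactSpace
  haveI : SecondCountableTopology ↥𝔠 := Φ.toHomeomorph.symm.secondCountableTopology
  obtain ⟨U, hU, hUi⟩ := exists_nhds_setLIntegral_lt_top_of_prod Φ (Measure.pi fun _ : Fin 3 => μF) μ𝔠 (Measure.pi fun _ : Fin 2 => μF) hgm hfg 0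
    ⟨U₃, hU₃, hU₃g⟩
  rw [show ((0 : Fin 2 → F'), (0 : Fin 3 → F')) = 0 from rfl, map_zero] at hU
  obtain ⟨O, hOU, hOo, h0O⟩ := mem_nhds_iff.1 hU
  refine ⟨O ∩ N₀, inter_mem (hOo.mem_nhds h0O) (hN₀o.mem_nhds h0N₀), ?_⟩
  -- on `N₀` the integrand IS `f`
  have hpt : ∀ Z ∈ O ∩ N₀,
      ((NNReal.sqrt (NNReal.sqrt (IsNonarchimedeanLocalField.normAbs K
        (Matrix.charpoly (diagonal ![a, a, b] + (Z : Matrix (Fin 3) (Fin 3) K))).discr)) : ℝ≥0∞))⁻¹ = f Z := by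
    intro Z hZ
    set p := Φ.symm Z with hp
    have hZp : Z = Φ p := (Φ.apply_symm_apply Z).symm
    obtain ⟨-, -, -, -, -, h02, h12, h20, h21⟩ := hΦ p
    have hdisc : (Matrix.charpoly (diagonal ![a, a, b] + (Z : Matrix (Fin 3) (Fin 3) K))).discr =
        ι (p.2 ⬝ᵥ B *ᵥ p.2) * R (Z : Matrix (Fin 3) (Fin 3) K) ^ 2 := by
      rw [hZp, discr_charpoly_diagonal_add_of_commute a b _ h02 h12 h20 h21, hq p]
    have hval : IsNonarchimedeanLocalField.normAbs K (Matrix.charpoly (diagonal ![a, a, b] + (Z : Matrix (Fin 3) (Fin 3) K))).discr =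
        IsNonarchimedeanLocalField.normAbs F' (p.2 ⬝ᵥ B *ᵥ p.2) ^ 2 * IsNonarchimedeanLocalField.normAbs K ((b - a) ^ 2) ^ 2 := by
      rw [hdisc, map_mul, map_pow, hιn, hRN Z hZ.2]
    rw [hval, sqrt_sqrt_sq_mul_sq, ENNReal.coe_mul, ENNReal.mul_inv (Or.inr ENNReal.coe_ne_top) (Or.inl ENNReal.coe_ne_top), coe_sqrt_inv_eq_rpow_neg_half, mul_comm]
  rw [setLIntegral_congr_fun (hOo.inter hN₀o).measurableSet hpt]
  exact lt_of_le_of_lt (lintegral_mono_set (inter_subset_left.trans hOU)) hUi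

end NormalForm

end Summit.HodgeConjecture.HodgeConjecture.Cruxes.H413.F0P3cStCharTSHCDescentSemisimpleNormalForm

end
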